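import Summits.QuantumFields.BalabanUV.Beta.GAN24.CombChargeTowerClosure
import Summits.QuantumFields.BalabanUV.Beta.GAN24.CombChargeTowerForcingAdapter
import Summits.QuantumFields.BalabanUV.Beta.GAN24.ForcingCellPairFormSucc

/-!
# `BalabanUV.Beta.GAN24.CombChargeTowerPairFormClosed` — binder row G-an2-4 ∕ (CONV-C), W-slot (α-0), ROW (C) AT LEVELS `≥ 1` (the OWNER's two-index tower, RULING
# R-gan24p1-g40-1): **THE COMB MEMBER's LEG-AND-BOND SYMMETRISED ZERO-MODE CHARGE IS A PAIR FORM AT EVERY LEVEL — road-P2's `hPair` — FROM THE E PINS ALONE; HENCE F9 §3's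
# EVEN-CLASS ROW `hZeven` GIVEN ONLY THE CROSSED-ORBIT CONSERVATION `hX`** — MY `CombChargeTowerClosure` with BOTH supplier sockets plugged: `hB0 :=` leaf-06 g55's
# `ForcingCellPairFormSucc.forcingCellPairForms` (the forcing's cell charge, E pins `cE = Lc^{d+1}`, `cVH = −½Lc^{2(d+1)}`, `3 ≤ Lc`), `hBF :=` MY
# `CombChargeTowerForcingAdapter.forcingFacePairForms_root` (the forcing's face reads at every period, no pin)
# (road-P2 chair `b2b-balaban-gan24-p2`, gen 51; journal [GAN24P2-G51-INTENT2])

NOT IN PRINT; OUR BOOKKEEPING ([folklore] composition BY NAME, three `exact`s; 0 `def`, 0 cited fact, 0 `def … : Prop`, 0 sorry).  HONEST FRAMING (cell contract, verbatim):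
«discharging `BetaPertH` makes Bałaban's UV stability UNCONDITIONAL — a real constructive-QFT result; it is NOT the continuum limit and NOT the Clay problem.»  HONEST DEPENDENCY
(verbatim): «continuum YM on T⁴ ⇐ BetaPertH ∧ nine spine estimates (0/9 proved); BetaPertH ⇐ (D1) ∧ (D4) ∧ CAP+tail; G-an2-4 gates asym, D1 and NE2/3/4.»

WHAT (letters of `CombChargeTowerClosure` VERBATIM; `T̃_i` the unit-scaled comb member at the in-block root `toSite r`, `Tc = c • wsym22 M`, generic `cΛ cE₂ cB c M`, generic
jointly `Lc`-covariant `LocStencil₂` border `vh₂S` with zero ff ∕ mm blocks; E pins; `3 ≤ Lc`):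
* **`pairFormLS_member_and_faceReads`** `(P) (hP0 : P 0 = Lc) (hPs : P (m+1) = Lc·P m) (i)`: `LS(zmode_Lc T̃_i)` is a pair form AND every `LS(FFsym_{P m} T̃_i)` is a pair form;
* **`pairFormLS_member`** `(i)`: road-P2's `hPair` at EVERY level — NO supplier hypothesis left (the period sequence `m ↦ Lc^{m+1}` chosen inside);
* **`zsymLegSymEven_of_crossed`** `(hX) (l) (κ κ' κ₁ κ₂) (heven)`: F9 §3's even-class row `hZeven` VERBATIM, GIVEN ONLY the crossed-orbit conservation `hX`.
READING (zero weight until every link is ✓): after this file the even-class half of road FP's D1 literal on the G-an2-4 side costs EXACTLY the crossed ledger `hX` ∕ `hXu`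
(leaf-03's `CrossedLedger*`, leaf-06's K7 values, the OWNER's (R-a)…(R-W)); `hPair` itself — the pair-form SHAPE of the member's symmetrised cell charge at every level — is a
theorem modulo the landings of the suppliers' staged chains (leaf-02 44a–51, leaf-04 M1–M4 + (A)-tower, leaf-06 g52–g55 EX chain + K6b, MY B–D3–Closure–Adapter).  Asserts NO
value of Bałaban's tables; discharges NOTHING of `hX` ∕ `hXu` ∕ (Q-L) ∕ (H1♮) ∕ (hW, hWall); NEVER «G-an2-4 closed» as (CONV-C); NOT D1, NOT `BetaPertH`, NOT continuum, NOT Clay.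
2026-08-24; no existing file touched.
-/

noncomputable section

open Finset
open scoped BigOperators
open Literature.MathematicalPhysics.QuantumFieldTheory
open Literature.MathematicalPhysics.QuantumFieldTheory.Balaban1983to89
open Literature.MathematicalPhysics.QuantumFieldTheory.Balaban1983to89.Beta
open ExpKernelCalculus (Site MKer shiftK)
open OneStepResolventKernel (Fib)
open OneStepKernelFamily (KInvStep)
open BalabanCompositeJets (LocStencil₂)
open SecondOrderResponse (W2SymOfK)
open BalabanStepJetsSucc (mmRead)
open BalabanStepW2 (K3OfK M2Of)
open WilsonVertex2Sym (wsym22)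
open AffineAveraging (box toSite)
open AveragingMixedJetTables (mixFFAt)
open PolarizationSign (reflSign)
open Summit.QuantumFields.BalabanUV.Beta.AxialDressingRooted (coDressKBmAt)
open Summit.QuantumFields.BalabanUV.Beta.HessKerDressedUnits (unitK unitS)
open Summit.QuantumFields.BalabanUV.Beta.SecondOrderUnits (unitM unitS₂ unitM₂)
open Summit.QuantumFields.BalabanUV.Beta.SpineRooted (T2RecAt SpureRecAt M1At)
open Summit.QuantumFields.BalabanUV.Beta.GAN24.CombesThomas (sfStep smStep)
open Summit.QuantumFields.BalabanUV.Beta.GAN24.BiStencilZeroMode (Tab zmode)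
open Summit.QuantumFields.BalabanUV.Beta.GAN24.CombChargeTowerClosure (pairFormLS_member_and_faceReads_of_forcingPairForms zsymLegSymEven_of_forcingPairForms_crossed)
open Summit.QuantumFields.BalabanUV.Beta.GAN24.CombChargeTowerForcingAdapter (forcingFacePairForms_root)
open Summit.QuantumFields.BalabanUV.Beta.GAN24.ForcingCellPairFormSucc (forcingCellPairForms)

namespace Summit.QuantumFields.BalabanUV.Beta.GAN24.CombChargeTowerPairFormClosed

variable {Lc : ℕ} [NeZero Lc] {r : Fin (3 + 1) → ℕ}

/-- NOT IN PRINT; OUR BOOKKEEPING.  **`hPair` AND ALL FACE READS, FROM THE PINS** (module docstring): MY `pairFormLS_member_and_faceReads_of_forcingPairForms` with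
`hB0 := forcingCellPairForms` (leaf-06 g55) and `hBF := forcingFacePairForms_root` (MY adapter over leaf-02 50c ∕ 51). -/
theorem pairFormLS_member_and_faceReads (hLc : 3 ≤ Lc) (hr : r ∈ box (3 + 1) Lc) {cE cVH : ℝ} (cΛ cE₂ cB c : ℝ) (M : ℕ)
    (hcE : cE = (Lc : ℝ) ^ (3 + 1)) (hcVH : cVH = -((Lc : ℝ) ^ (3 + 1) * (1 / 2) * (Lc : ℝ) ^ (3 + 1)))
    {vh₂S : Tab 3} (hBff : ∀ κ u κ' u' x z (α β : Fin (3 + 1)), vh₂S κ u κ' u' x z (Sum.inl α) (Sum.inl β) = 0)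
    (hBmm : ∀ κ u κ' u' x z (μ ν : Fin (3 + 1)), vh₂S κ u κ' u' x z (Sum.inr μ) (Sum.inr ν) = 0)
    (hB : ∃ C δ : ℝ, 0 < δ ∧ LocStencil₂ vh₂S C δ)
    (hBt : ∀ (κ : Fin (3 + 1)) (u : Fin (3 + 1) → ℤ) (κ' : Fin (3 + 1)) (u' t : Fin (3 + 1) → ℤ),
      vh₂S κ (u + (Lc : ℤ) • t) κ' (u' + (Lc : ℤ) • t) = shiftK (-((Lc : ℤ) • t)) (vh₂S κ u κ' u'))
    (P : ℕ → ℕ) (hP0 : P 0 = Lc) (hPs : ∀ m, P (m + 1) = Lc * P m) (i : ℕ) :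
    (∃ R : Fin (3 + 1) → Fin (3 + 1) → Fin (3 + 1) → Fin (3 + 1) → ℝ,
      (∀ a b c e : Fin (3 + 1), R b a c e = -R a b c e) ∧ (∀ a b c e : Fin (3 + 1), R a b e c = -R a b c e) ∧
      ∀ κ κ' κ₁ κ₂ : Fin (3 + 1),
        (zmode Lc (unitS₂ (sfStep Lc i) (smStep 3 Lc i) (T2RecAt 3 Lc (toSite r) cE cVH cΛ cE₂ cB (c • wsym22 M) vh₂S (mixFFAt (toSite r) Lc) i)) κ κ' (Sum.inl κ₁) (Sum.inl κ₂)
      + zmode Lc (unitS₂ (sfStep Lc i) (smStep 3 Lc i) (T2RecAt 3 Lc (toSite r) cE cVH cΛ cE₂ cB (c • wsym22 M) vh₂S (mixFFAt (toSite r) Lc) i)) κ' κ (Sum.inl κ₁) (Sum.inl κ₂)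
      + (zmode Lc (unitS₂ (sfStep Lc i) (smStep 3 Lc i) (T2RecAt 3 Lc (toSite r) cE cVH cΛ cE₂ cB (c • wsym22 M) vh₂S (mixFFAt (toSite r) Lc) i)) κ κ' (Sum.inl κ₂) (Sum.inl κ₁)
      + zmode Lc (unitS₂ (sfStep Lc i) (smStep 3 Lc i) (T2RecAt 3 Lc (toSite r) cE cVH cΛ cE₂ cB (c • wsym22 M) vh₂S (mixFFAt (toSite r) Lc) i)) κ' κ (Sum.inl κ₂) (Sum.inl κ₁)))
          = R κ κ₁ κ' κ₂ + R κ' κ₁ κ κ₂ + (R κ κ₂ κ' κ₁ + R κ' κ₂ κ κ₁))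
    ∧ (∀ m : ℕ, ∃ R : Fin (3 + 1) → Fin (3 + 1) → Fin (3 + 1) → Fin (3 + 1) → ℝ,
      (∀ a b c e : Fin (3 + 1), R b a c e = -R a b c e) ∧ (∀ a b c e : Fin (3 + 1), R a b e c = -R a b c e) ∧
      ∀ κ κ' κ₁ κ₂ : Fin (3 + 1),
        (((∑ bb ∈ box (3 + 1) (P m), ∑' u' : Site (3 + 1), ∑' x : Site (3 + 1), ∑' z : Site (3 + 1),
          (if toSite bb κ % ((P m : ℕ) : ℤ) = ((P m : ℕ) : ℤ) - 1 ∧ u' κ' % ((P m : ℕ) : ℤ) = ((P m : ℕ) : ℤ) - 1 ∧ x κ₁ % ((P m : ℕ) : ℤ) = ((P m : ℕ) : ℤ) - 1 ∧ z κ₂ % ((P m : ℕ) : ℤ) = ((P m : ℕ) : ℤ) - 1 then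
            (unitS₂ (sfStep Lc i) (smStep 3 Lc i) (T2RecAt 3 Lc (toSite r) cE cVH cΛ cE₂ cB (c • wsym22 M) vh₂S (mixFFAt (toSite r) Lc) i)) κ (toSite bb) κ' u' x z (Sum.inl κ₁) (Sum.inl κ₂) else 0))
        + (∑ bb ∈ box (3 + 1) (P m), ∑' u' : Site (3 + 1), ∑' x : Site (3 + 1), ∑' z : Site (3 + 1),
          (if toSite bb κ' % ((P m : ℕ) : ℤ) = ((P m : ℕ) : ℤ) - 1 ∧ u' κ % ((P m : ℕ) : ℤ) = ((P m : ℕ) : ℤ) - 1 ∧ x κ₁ % ((P m : ℕ) : ℤ) = ((P m : ℕ) : ℤ) - 1 ∧ z κ₂ % ((P m : ℕ) : ℤ) = ((P m : ℕ) : ℤ) - 1 then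
            (unitS₂ (sfStep Lc i) (smStep 3 Lc i) (T2RecAt 3 Lc (toSite r) cE cVH cΛ cE₂ cB (c • wsym22 M) vh₂S (mixFFAt (toSite r) Lc) i)) κ' (toSite bb) κ u' x z (Sum.inl κ₁) (Sum.inl κ₂) else 0)))
      + ((∑ bb ∈ box (3 + 1) (P m), ∑' u' : Site (3 + 1), ∑' x : Site (3 + 1), ∑' z : Site (3 + 1),
          (if toSite bb κ' % ((P m : ℕ) : ℤ) = ((P m : ℕ) : ℤ) - 1 ∧ u' κ % ((P m : ℕ) : ℤ) = ((P m : ℕ) : ℤ) - 1 ∧ x κ₁ % ((P m : ℕ) : ℤ) = ((P m : ℕ) : ℤ) - 1 ∧ z κ₂ % ((P m : ℕ) : ℤ) = ((P m : ℕ) : ℤ) - 1 then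
            (unitS₂ (sfStep Lc i) (smStep 3 Lc i) (T2RecAt 3 Lc (toSite r) cE cVH cΛ cE₂ cB (c • wsym22 M) vh₂S (mixFFAt (toSite r) Lc) i)) κ' (toSite bb) κ u' x z (Sum.inl κ₁) (Sum.inl κ₂) else 0))
        + (∑ bb ∈ box (3 + 1) (P m), ∑' u' : Site (3 + 1), ∑' x : Site (3 + 1), ∑' z : Site (3 + 1),
          (if toSite bb κ % ((P m : ℕ) : ℤ) = ((P m : ℕ) : ℤ) - 1 ∧ u' κ' % ((P m : ℕ) : ℤ) = ((P m : ℕ) : ℤ) - 1 ∧ x κ₁ % ((P m : ℕ) : ℤ) = ((P m : ℕ) : ℤ) - 1 ∧ z κ₂ % ((P m : ℕ) : ℤ) = ((P m : ℕ) : ℤ) - 1 then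
            (unitS₂ (sfStep Lc i) (smStep 3 Lc i) (T2RecAt 3 Lc (toSite r) cE cVH cΛ cE₂ cB (c • wsym22 M) vh₂S (mixFFAt (toSite r) Lc) i)) κ (toSite bb) κ' u' x z (Sum.inl κ₁) (Sum.inl κ₂) else 0)))
      + (((∑ bb ∈ box (3 + 1) (P m), ∑' u' : Site (3 + 1), ∑' x : Site (3 + 1), ∑' z : Site (3 + 1),
          (if toSite bb κ % ((P m : ℕ) : ℤ) = ((P m : ℕ) : ℤ) - 1 ∧ u' κ' % ((P m : ℕ) : ℤ) = ((P m : ℕ) : ℤ) - 1 ∧ x κ₂ % ((P m : ℕ) : ℤ) = ((P m : ℕ) : ℤ) - 1 ∧ z κ₁ % ((P m : ℕ) : ℤ) = ((P m : ℕ) : ℤ) - 1 then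
            (unitS₂ (sfStep Lc i) (smStep 3 Lc i) (T2RecAt 3 Lc (toSite r) cE cVH cΛ cE₂ cB (c • wsym22 M) vh₂S (mixFFAt (toSite r) Lc) i)) κ (toSite bb) κ' u' x z (Sum.inl κ₂) (Sum.inl κ₁) else 0))
        + (∑ bb ∈ box (3 + 1) (P m), ∑' u' : Site (3 + 1), ∑' x : Site (3 + 1), ∑' z : Site (3 + 1),
          (if toSite bb κ' % ((P m : ℕ) : ℤ) = ((P m : ℕ) : ℤ) - 1 ∧ u' κ % ((P m : ℕ) : ℤ) = ((P m : ℕ) : ℤ) - 1 ∧ x κ₂ % ((P m : ℕ) : ℤ) = ((P m : ℕ) : ℤ) - 1 ∧ z κ₁ % ((P m : ℕ) : ℤ) = ((P m : ℕ) : ℤ) - 1 then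
            (unitS₂ (sfStep Lc i) (smStep 3 Lc i) (T2RecAt 3 Lc (toSite r) cE cVH cΛ cE₂ cB (c • wsym22 M) vh₂S (mixFFAt (toSite r) Lc) i)) κ' (toSite bb) κ u' x z (Sum.inl κ₂) (Sum.inl κ₁) else 0)))
      + ((∑ bb ∈ box (3 + 1) (P m), ∑' u' : Site (3 + 1), ∑' x : Site (3 + 1), ∑' z : Site (3 + 1),
          (if toSite bb κ' % ((P m : ℕ) : ℤ) = ((P m : ℕ) : ℤ) - 1 ∧ u' κ % ((P m : ℕ) : ℤ) = ((P m : ℕ) : ℤ) - 1 ∧ x κ₂ % ((P m : ℕ) : ℤ) = ((P m : ℕ) : ℤ) - 1 ∧ z κ₁ % ((P m : ℕ) : ℤ) = ((P m : ℕ) : ℤ) - 1 then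
            (unitS₂ (sfStep Lc i) (smStep 3 Lc i) (T2RecAt 3 Lc (toSite r) cE cVH cΛ cE₂ cB (c • wsym22 M) vh₂S (mixFFAt (toSite r) Lc) i)) κ' (toSite bb) κ u' x z (Sum.inl κ₂) (Sum.inl κ₁) else 0))
        + (∑ bb ∈ box (3 + 1) (P m), ∑' u' : Site (3 + 1), ∑' x : Site (3 + 1), ∑' z : Site (3 + 1),
          (if toSite bb κ % ((P m : ℕ) : ℤ) = ((P m : ℕ) : ℤ) - 1 ∧ u' κ' % ((P m : ℕ) : ℤ) = ((P m : ℕ) : ℤ) - 1 ∧ x κ₂ % ((P m : ℕ) : ℤ) = ((P m : ℕ) : ℤ) - 1 ∧ z κ₁ % ((P m : ℕ) : ℤ) = ((P m : ℕ) : ℤ) - 1 then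
            (unitS₂ (sfStep Lc i) (smStep 3 Lc i) (T2RecAt 3 Lc (toSite r) cE cVH cΛ cE₂ cB (c • wsym22 M) vh₂S (mixFFAt (toSite r) Lc) i)) κ (toSite bb) κ' u' x z (Sum.inl κ₂) (Sum.inl κ₁) else 0)))))
          = R κ κ₁ κ' κ₂ + R κ' κ₁ κ κ₂ + (R κ κ₂ κ' κ₁ + R κ' κ₂ κ κ₁)) :=
  pairFormLS_member_and_faceReads_of_forcingPairForms (le_trans (by norm_num) hLc) hr cE cVH cΛ cE₂ cB c M hBff hBmm hB hBt P hP0 hPs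
    (forcingCellPairForms hLc hr cΛ cE₂ cB hcE hcVH hBff) (forcingFacePairForms_root (le_trans (by norm_num) hLc) hr cE cVH cΛ cE₂ cB hBff P hP0 hPs) i

/-- NOT IN PRINT; OUR BOOKKEEPING.  **road-P2's `hPair` AT EVERY LEVEL, NO SUPPLIER HYPOTHESIS LEFT** (module docstring): the comb member's leg-and-bond symmetrised
zero-mode charge `LS(zmode_Lc T̃_i)` is an antisymmetric-pair form, every `i` (period sequence `m ↦ Lc^(m+1)` chosen inside). -/
theorem pairFormLS_member (hLc : 3 ≤ Lc) (hr : r ∈ box (3 + 1) Lc) {cE cVH : ℝ} (cΛ cE₂ cB c : ℝ) (M : ℕ)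
    (hcE : cE = (Lc : ℝ) ^ (3 + 1)) (hcVH : cVH = -((Lc : ℝ) ^ (3 + 1) * (1 / 2) * (Lc : ℝ) ^ (3 + 1)))
    {vh₂S : Tab 3} (hBff : ∀ κ u κ' u' x z (α β : Fin (3 + 1)), vh₂S κ u κ' u' x z (Sum.inl α) (Sum.inl β) = 0)
    (hBmm : ∀ κ u κ' u' x z (μ ν : Fin (3 + 1)), vh₂S κ u κ' u' x z (Sum.inr μ) (Sum.inr ν) = 0)
    (hB : ∃ C δ : ℝ, 0 < δ ∧ LocStencil₂ vh₂S C δ)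
    (hBt : ∀ (κ : Fin (3 + 1)) (u : Fin (3 + 1) → ℤ) (κ' : Fin (3 + 1)) (u' t : Fin (3 + 1) → ℤ),
      vh₂S κ (u + (Lc : ℤ) • t) κ' (u' + (Lc : ℤ) • t) = shiftK (-((Lc : ℤ) • t)) (vh₂S κ u κ' u')) (i : ℕ) :
    ∃ R : Fin (3 + 1) → Fin (3 + 1) → Fin (3 + 1) → Fin (3 + 1) → ℝ,
      (∀ a b c e : Fin (3 + 1), R b a c e = -R a b c e) ∧ (∀ a b c e : Fin (3 + 1), R a b e c = -R a b c e) ∧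
      ∀ κ κ' κ₁ κ₂ : Fin (3 + 1),
        (zmode Lc (unitS₂ (sfStep Lc i) (smStep 3 Lc i) (T2RecAt 3 Lc (toSite r) cE cVH cΛ cE₂ cB (c • wsym22 M) vh₂S (mixFFAt (toSite r) Lc) i)) κ κ' (Sum.inl κ₁) (Sum.inl κ₂)
      + zmode Lc (unitS₂ (sfStep Lc i) (smStep 3 Lc i) (T2RecAt 3 Lc (toSite r) cE cVH cΛ cE₂ cB (c • wsym22 M) vh₂S (mixFFAt (toSite r) Lc) i)) κ' κ (Sum.inl κ₁) (Sum.inl κ₂)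
      + (zmode Lc (unitS₂ (sfStep Lc i) (smStep 3 Lc i) (T2RecAt 3 Lc (toSite r) cE cVH cΛ cE₂ cB (c • wsym22 M) vh₂S (mixFFAt (toSite r) Lc) i)) κ κ' (Sum.inl κ₂) (Sum.inl κ₁)
      + zmode Lc (unitS₂ (sfStep Lc i) (smStep 3 Lc i) (T2RecAt 3 Lc (toSite r) cE cVH cΛ cE₂ cB (c • wsym22 M) vh₂S (mixFFAt (toSite r) Lc) i)) κ' κ (Sum.inl κ₂) (Sum.inl κ₁)))
          = R κ κ₁ κ' κ₂ + R κ' κ₁ κ κ₂ + (R κ κ₂ κ' κ₁ + R κ' κ₂ κ κ₁) :=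
  (pairFormLS_member_and_faceReads hLc hr cΛ cE₂ cB c M hcE hcVH hBff hBmm hB hBt (fun m => Lc ^ (m + 1)) (show Lc ^ (0 + 1) = Lc by simp) (fun m => show Lc ^ (m + 1 + 1) = Lc * Lc ^ (m + 1) by ring) i).1

/-- NOT IN PRINT; OUR BOOKKEEPING.  **F9 §3's EVEN-CLASS ROW GIVEN ONLY THE CROSSED-ORBIT CONSERVATION `hX`** (module docstring): MY
`zsymLegSymEven_of_forcingPairForms_crossed` with both sockets plugged. -/
theorem zsymLegSymEven_of_crossed (hLc : 3 ≤ Lc) (hr : r ∈ box (3 + 1) Lc) {cE cVH : ℝ} (cΛ cE₂ cB c : ℝ) (M : ℕ)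
    (hcE : cE = (Lc : ℝ) ^ (3 + 1)) (hcVH : cVH = -((Lc : ℝ) ^ (3 + 1) * (1 / 2) * (Lc : ℝ) ^ (3 + 1)))
    {vh₂S : Tab 3} (hBff : ∀ κ u κ' u' x z (α β : Fin (3 + 1)), vh₂S κ u κ' u' x z (Sum.inl α) (Sum.inl β) = 0)
    (hBmm : ∀ κ u κ' u' x z (μ ν : Fin (3 + 1)), vh₂S κ u κ' u' x z (Sum.inr μ) (Sum.inr ν) = 0)
    (hB : ∃ C δ : ℝ, 0 < δ ∧ LocStencil₂ vh₂S C δ)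
    (hBt : ∀ (κ : Fin (3 + 1)) (u : Fin (3 + 1) → ℤ) (κ' : Fin (3 + 1)) (u' t : Fin (3 + 1) → ℤ),
      vh₂S κ (u + (Lc : ℤ) • t) κ' (u' + (Lc : ℤ) • t) = shiftK (-((Lc : ℤ) • t)) (vh₂S κ u κ' u'))
    (hX : ∀ (l : ℕ) (a b : Fin (3 + 1)), a ≠ b →
      zmode Lc (unitS₂ (sfStep Lc (l + 1 + 1)) (smStep 3 Lc (l + 1 + 1)) (T2RecAt 3 Lc (toSite r) cE cVH cΛ cE₂ cB (c • wsym22 M) vh₂S (mixFFAt (toSite r) Lc) (l + 1 + 1))) a b (Sum.inl a) (Sum.inl b) + zmode Lc (unitS₂ (sfStep Lc (l + 1 + 1)) (smStep 3 Lc (l + 1 + 1)) (T2RecAt 3 Lc (toSite r) cE cVH cΛ cE₂ cB (c • wsym22 M) vh₂S (mixFFAt (toSite r) Lc) (l + 1 + 1))) b a (Sum.inl a) (Sum.inl b) + (zmode Lc (unitS₂ (sfStep Lc (l + 1 + 1)) (smStep 3 Lc (l + 1 + 1)) (T2RecAt 3 Lc (toSite r) cE cVH cΛ cE₂ cB (c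 • wsym22 M) vh₂S (mixFFAt (toSite r) Lc) (l + 1 + 1))) a b (Sum.inl b) (Sum.inl a) + zmode Lc (unitS₂ (sfStep Lc (l + 1 + 1)) (smStep 3 Lc (l + 1 + 1)) (T2RecAt 3 Lc (toSite r) cE cVH cΛ cE₂ cB (c • wsym22 M) vh₂S (mixFFAt (toSite r) Lc) (l + 1 + 1))) b a (Sum.inl b) (Sum.inl a))
      = zmode Lc (unitS₂ (sfStep Lc (l + 1)) (smStep 3 Lc (l + 1)) (T2RecAt 3 Lc (toSite r) cE cVH cΛ cE₂ cB (c • wsym22 M) vh₂S (mixFFAt (toSite r) Lc) (l + 1))) a b (Sum.inl a) (Sum.inl b) + zmode Lc (unitS₂ (sfStep Lc (l + 1)) (smStep 3 Lc (l + 1)) (T2RecAt 3 Lc (toSite r) cE cVH cΛ cE₂ cB (c • wsym22 M) vh₂S (mixFFAt (toSite r) Lc) (l + 1))) b a (Sum.inl a) (Sum.inl b) + (zmode Lc (unitS₂ (sfStep Lc (l + 1)) (smStep 3 Lc (l + 1)) (T2RecAt 3 Lc (toSite r) cE cVH cΛ cE₂ cB (c • wsym22 M) vh₂S (mixFFAt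 (toSite r) Lc) (l + 1))) a b (Sum.inl b) (Sum.inl a) + zmode Lc (unitS₂ (sfStep Lc (l + 1)) (smStep 3 Lc (l + 1)) (T2RecAt 3 Lc (toSite r) cE cVH cΛ cE₂ cB (c • wsym22 M) vh₂S (mixFFAt (toSite r) Lc) (l + 1))) b a (Sum.inl b) (Sum.inl a)))
    (l : ℕ) (κ κ' κ₁ κ₂ : Fin (3 + 1)) (heven : ¬ ∃ α : Fin 4, reflSign α κ * reflSign α κ' * reflSign α κ₁ * reflSign α κ₂ = -1) :
    zmode Lc (unitS₂ (sfStep Lc (l + 1 + 1)) (smStep 3 Lc (l + 1 + 1)) (T2RecAt 3 Lc (toSite r) cE cVH cΛ cE₂ cB (c • wsym22 M) vh₂S (mixFFAt (toSite r) Lc) (l + 1 + 1))) κ κ' (Sum.inl κ₁) (Sum.inl κ₂)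
        + zmode Lc (unitS₂ (sfStep Lc (l + 1 + 1)) (smStep 3 Lc (l + 1 + 1)) (T2RecAt 3 Lc (toSite r) cE cVH cΛ cE₂ cB (c • wsym22 M) vh₂S (mixFFAt (toSite r) Lc) (l + 1 + 1))) κ' κ (Sum.inl κ₁) (Sum.inl κ₂)
        + (zmode Lc (unitS₂ (sfStep Lc (l + 1 + 1)) (smStep 3 Lc (l + 1 + 1)) (T2RecAt 3 Lc (toSite r) cE cVH cΛ cE₂ cB (c • wsym22 M) vh₂S (mixFFAt (toSite r) Lc) (l + 1 + 1))) κ κ' (Sum.inl κ₂) (Sum.inl κ₁)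
        + zmode Lc (unitS₂ (sfStep Lc (l + 1 + 1)) (smStep 3 Lc (l + 1 + 1)) (T2RecAt 3 Lc (toSite r) cE cVH cΛ cE₂ cB (c • wsym22 M) vh₂S (mixFFAt (toSite r) Lc) (l + 1 + 1))) κ' κ (Sum.inl κ₂) (Sum.inl κ₁))
      = zmode Lc (unitS₂ (sfStep Lc (l + 1)) (smStep 3 Lc (l + 1)) (T2RecAt 3 Lc (toSite r) cE cVH cΛ cE₂ cB (c • wsym22 M) vh₂S (mixFFAt (toSite r) Lc) (l + 1))) κ κ' (Sum.inl κ₁) (Sum.inl κ₂)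
        + zmode Lc (unitS₂ (sfStep Lc (l + 1)) (smStep 3 Lc (l + 1)) (T2RecAt 3 Lc (toSite r) cE cVH cΛ cE₂ cB (c • wsym22 M) vh₂S (mixFFAt (toSite r) Lc) (l + 1))) κ' κ (Sum.inl κ₁) (Sum.inl κ₂)
        + (zmode Lc (unitS₂ (sfStep Lc (l + 1)) (smStep 3 Lc (l + 1)) (T2RecAt 3 Lc (toSite r) cE cVH cΛ cE₂ cB (c • wsym22 M) vh₂S (mixFFAt (toSite r) Lc) (l + 1))) κ κ' (Sum.inl κ₂) (Sum.inl κ₁)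
        + zmode Lc (unitS₂ (sfStep Lc (l + 1)) (smStep 3 Lc (l + 1)) (T2RecAt 3 Lc (toSite r) cE cVH cΛ cE₂ cB (c • wsym22 M) vh₂S (mixFFAt (toSite r) Lc) (l + 1))) κ' κ (Sum.inl κ₂) (Sum.inl κ₁)) :=
  zsymLegSymEven_of_forcingPairForms_crossed (le_trans (by norm_num) hLc) hr cE cVH cΛ cE₂ cB c M hBff hBmm hB hBt (fun m => Lc ^ (m + 1)) (show Lc ^ (0 + 1) = Lc by simp) (fun m => show Lc ^ (m + 1 + 1) = Lc * Lc ^ (m + 1) by ring)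
    (forcingCellPairForms hLc hr cΛ cE₂ cB hcE hcVH hBff)
    (forcingFacePairForms_root (le_trans (by norm_num) hLc) hr cE cVH cΛ cE₂ cB hBff (fun m => Lc ^ (m + 1)) (show Lc ^ (0 + 1) = Lc by simp) (fun m => show Lc ^ (m + 1 + 1) = Lc * Lc ^ (m + 1) by ring)) hX l κ κ' κ₁ κ₂ heven

end Summit.QuantumFields.BalabanUV.Beta.GAN24.CombChargeTowerPairFormClosed

end
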